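import Mathlib.RingTheory.Ideal.UFD
import Mathlib.RingTheory.Localization.Algebra
import Mathlib.RingTheory.KrullDimension.PID
import Mathlib.RingTheory.Polynomial.UniqueFactorization
import Mathlib.RingTheory.Localization.FractionRing
import Mathlib.Algebra.Polynomial.Div
import HarnessLib

/-!
# Barrier (Schanuel) `NesterenkoModularScope`: primes of `R[X]` over `(0)` are principal — proofs only

`Literature/Barriers/Schanuel/NesterenkoModularScopePrincipalPrime.lean` — proofs-only groundwork
(no definitions, nothing asserted) for LNM 1752 Ch. 10 Proposition 5.1 (named fact
`NesterenkoPhilippon2001_ch10_prop_5_1`). The printed proof (p. 166) uses twice that certain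
prime ideals are principal: "if `𝔮 = (0)` then `𝔭 = (A)`" (a prime `𝔭 ⊂ ℂ[z, x₁, x₂, x₃]` with
`𝔭 ∩ ℂ[x₁, x₂, x₃] = 0`) and "if `𝔮 ≠ (0)` and `𝔮 ∩ ℂ[x₁, x₂] = (0)`, then `𝔮 = (A)`". Both are
instances of:

* `exists_prime_eq_span_of_comap_C_eq_bot` — **for a UFD `R`, a non-zero prime ideal `𝔮` of
  `R[X]` with `𝔮 ∩ R = 0` is generated by a prime element** (it corresponds to a non-zero prime
  of the PID `K[X]`, `K = Frac R`, so has height one, and height-one primes of the UFD `R[X]` are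
  principal — Mathlib `UniqueFactorizationMonoid.isPrincipal_of_height_eq_one`).

## References

* [NesterenkoPhilippon2001] LNM 1752, Ch. 10 §5, proof of Prop. 5.1 (p. 166).
-/

noncomputable section

open Polynomial

namespace Literature.Barriers.Schanuel

/-- **Primes of `R[X]` lying over `(0) ⊂ R` are principal** (`R` a UFD): a non-zero prime ideal
`𝔮 ⊂ R[X]` with `𝔮 ∩ R = 0` is `(A)` for a prime element `A`.
[cite: NesterenkoPhilippon2001, Ch. 10 §5, proof of Prop. 5.1 (p. 166: "`𝔭 = (A)`", "`𝔮 = (A)`")] -/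
theorem exists_prime_eq_span_of_comap_C_eq_bot {R : Type*} [CommRing R] [IsDomain R]
    [UniqueFactorizationMonoid R] (𝔮 : Ideal R[X]) [h𝔮 : 𝔮.IsPrime] (h0 : 𝔮 ≠ ⊥)
    (hC : 𝔮.comap (C : R →+* R[X]) = ⊥) :
    ∃ A : R[X], Prime A ∧ 𝔮 = Ideal.span {A} := by
  classical
  let K := FractionRing R
  letI : Algebra R[X] K[X] := Polynomial.algebra R K
  set M : Submonoid R[X] := (nonZeroDivisors R).map (C : R →+* R[X]) with hM
  haveI : IsLocalization M K[X] := hM ▸ Polynomial.isLocalization (nonZeroDivisors R) K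
  have hdisj : Disjoint (M : Set R[X]) (𝔮 : Set R[X]) := by
    rw [Set.disjoint_left]
    intro a haM haq
    obtain ⟨c, hc, rfl⟩ := Submonoid.mem_map.mp haM
    have hcq : c ∈ 𝔮.comap (C : R →+* R[X]) := haq
    rw [hC, Ideal.mem_bot] at hcq
    exact nonZeroDivisors.ne_zero hc hcq
  have hMle : M ≤ nonZeroDivisors R[X] := by
    intro a haM
    obtain ⟨c, hc, rfl⟩ := Submonoid.mem_map.mp haM
    exact mem_nonZeroDivisors_of_ne_zero (C_ne_zero.mpr (nonZeroDivisors.ne_zero hc))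
  have hinj : Function.Injective (algebraMap R[X] K[X]) := IsLocalization.injective K[X] hMle
  haveI hprime : (𝔮.map (algebraMap R[X] K[X])).IsPrime :=
    IsLocalization.isPrime_of_isPrime_disjoint M K[X] 𝔮 h𝔮 hdisj
  have hne : 𝔮.map (algebraMap R[X] K[X]) ≠ ⊥ := fun h =>
    h0 ((Ideal.map_eq_bot_iff_of_injective hinj).mp h)
  haveI : (𝔮.map (algebraMap R[X] K[X])).IsMaximal := IsPrime.to_maximal_ideal hne
  have h1 : (𝔮.map (algebraMap R[X] K[X])).height = 1 :=
    IsPrincipalIdealRing.height_eq_one_of_isMaximal _ (Polynomial.not_isField K)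
  have hq1 : 𝔮.height = 1 := by
    rw [← IsLocalization.height_map_of_disjoint (S := K[X]) M 𝔮 hdisj, h1]
  haveI : 𝔮.IsPrincipal := UniqueFactorizationMonoid.isPrincipal_of_height_eq_one hq1
  exact ⟨Submodule.IsPrincipal.generator 𝔮, Submodule.IsPrincipal.prime_generator_of_isPrime 𝔮 h0,
    (Ideal.span_singleton_generator 𝔮).symm⟩

end Literature.Barriers.Schanuel

end
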